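import Summits.CriticalPhenomena.PercolationContinuityZ3.Theorems.Transplant.AutChartOrbitsGoodCoordinates
import HarnessLib

/-!
# The orbit datum with QUASI-STEPS (customer side of the path-step rung (N3-b), I): an action with finitely many orbits, a character killing every stabiliser,
# `N`-bounded edge values and TIGHT QUASI-STEPS `± N eᵢ` (walks of length `≤ M` whose chart track stays within sup-distance `N`) on a transversal; the
# zero-offset chart, quasi-steps at every vertex, boxed walks, kernel walks

builds on p205010 (kernel theorem, internal audit signed; external expert review pending) — nothing in this file uses p205010 and nothing here is a percolation
statement or a claim about any node.  Lane `prim-bschramm`, seat `prim-bschramm-p3` gen 28 (design owner; N3B-RUNG.md §6 / P3-NILPOTENT §20.6: «the orbit datum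
generalises verbatim to quasi-steps»).  Helper file (`--supports stmt-CriticalPhenomena-4575 --as helper`).  DEFINITIONS + immediate API; the fattened cylinder
connectivity (κ″) and the EXISTENCE of the datum for every action with finitely many orbits and a rank-two character (off exponential growth) are the sequel
«AutChartOrbitsQCylinders».

WHY.  «AutChartOrbitsDatum» (p492343) carries SINGLE-EDGE steps (`OrbitDatum.step`) — they can fail with several orbits (`Z2Rot.no_singleEdgeStep_chart`, p495173) —
whereas «AutChartOrbitsGoodCoordinates» (p494591) shows that TIGHT QUASI-STEPS never fail.  This file is p492343 with `step` replaced by `qstep` (and the scale `M`):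
everything that did not read the steps (chart, Lipschitz bound, boxed walks, kernel walks) is the same text; `qstep_at` transports the representative's quasi-step
walk to every vertex.  It is the customer-side structure the quasi-step carrier of the next rung would read (N3B-RUNG §3); no carrier is defined here.
[cite: KozmaNitzan2024, §4 p. 16 (Lemma 8)] [cite: MartineauTassion2017, §3.2 (good coordinates)] [cite: BenjaminiSchramm1996, §2 (almost transitive graphs)]
[cite: MilnorSolvableGrowth1968, Lemma 1]
-/

noncomputable section

namespace Summit.CriticalPhenomena.PercolationContinuityZ3.Theorems.Transplant

open SimpleGraph Filter Literature.Barriers.CriticalPhenomena Literature.Probability.LatticeModels Literature.Probability.Percolation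
open scoped Classical

namespace AutChart

variable {V : Type} {G : SimpleGraph V} {A : Type} [Group A] [MulAction A V]

/-- **Orbit datum with quasi-steps**: as `OrbitDatum` (p492343) but with the single-edge step field replaced by TIGHT QUASI-STEPS at every representative — a walk of
length `≤ M` from `r` to some `a • r'` (`r' ∈ reps`) with `ψ a = N σ eᵢ`, every vertex `b • r''` of which has `‖ψ b‖_∞ ≤ N`. [cite: KozmaNitzan2024, §4 p. 16 (Lemma 8)]
[cite: BenjaminiSchramm1996, §2 (almost transitive graphs)] [cite: MilnorSolvableGrowth1968, Lemma 1] -/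
structure OrbitQDatum (G : SimpleGraph V) (A : Type) [Group A] [MulAction A V] where
  /-- the action is by graph automorphisms -/
  act : IsActionByAut G A
  /-- the graph is connected -/
  conn : G.Connected
  /-- the representatives -/
  reps : Finset V
  /-- every vertex is a translate of a representative -/
  cover : ∀ w : V, ∃ a : A, ∃ r ∈ reps, a • r = w
  /-- the representatives are pairwise inequivalent (a transversal) -/
  trans : ∀ r ∈ reps, ∀ r' ∈ reps, ∀ a : A, a • r = r' → r = r'
  /-- the character -/
  ψ : A → Site 2
  /-- additivity -/
  ψ_mul : ∀ a b : A, ψ (a * b) = ψ a + ψ b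
  /-- `ψ` kills EVERY vertex stabiliser -/
  ψ_stab : ∀ (v : V), ∀ h ∈ MulAction.stabilizer A v, ψ h = 0
  /-- the scale -/
  N : ℕ
  /-- the scale is positive -/
  one_le_N : 1 ≤ N
  /-- sup-norm `≤ N` on the elements carrying a representative next to a representative -/
  lipN : ∀ r ∈ reps, ∀ r' ∈ reps, ∀ a : A, G.Adj r (a • r') → ∀ i : Fin 2, |ψ a i| ≤ N
  /-- the quasi-step length -/
  M : ℕ
  /-- TIGHT QUASI-STEPS at every representative -/
  qstep : ∀ r ∈ reps, ∀ (i : Fin 2) (σ : ℤˣ), ∃ (a : A) (r' : V) (p : G.Walk r (a • r')), r' ∈ reps ∧ p.length ≤ M ∧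
    ψ a = Pi.single i ((N : ℤ) * σ) ∧ ∀ x ∈ p.support, ∀ (b : A) (r'' : V), r'' ∈ reps → b • r'' = x → ∀ j : Fin 2, |ψ b j| ≤ N
  /-- the kernel displacement bound -/
  m : ℕ
  /-- at every base `ker ψ` is generated by kernel elements moving the base by at most `m` -/
  ker_gen : ∀ r ∈ reps, ∀ k : A, ψ k = 0 → k ∈ Subgroup.closure {g : A | ψ g = 0 ∧ g • r ∈ graphBall G r m}

namespace OrbitQDatum


/-- `ψ 1 = 0`. [folklore] -/
theorem ψ_one (D : OrbitQDatum G A) : D.ψ 1 = 0 := by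
  have e := D.ψ_mul 1 1
  rw [one_mul] at e
  exact left_eq_add.1 e

/-- `ψ a⁻¹ = −ψ a`. [folklore] -/
theorem ψ_inv (D : OrbitQDatum G A) (a : A) : D.ψ a⁻¹ = -D.ψ a := by
  have e := D.ψ_mul a⁻¹ a
  rw [inv_mul_cancel, D.ψ_one] at e
  exact eq_neg_of_add_eq_zero_left e.symm

/-- The section of a vertex: `sec w • typ w = w`. [folklore] -/
def sec (D : OrbitQDatum G A) (w : V) : A := osec D.cover w

/-- The type of a vertex (its representative). [folklore] -/
def typ (D : OrbitQDatum G A) (w : V) : V := otyp D.cover w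

/-- `typ w ∈ reps`. [folklore] -/
theorem typ_mem (D : OrbitQDatum G A) (w : V) : D.typ w ∈ D.reps := otyp_mem D.cover w

/-- `sec w • typ w = w`. [folklore] -/
@[simp] theorem sec_smul (D : OrbitQDatum G A) (w : V) : D.sec w • D.typ w = w := osec_smul D.cover w

/-- `typ r = r` on the transversal. [folklore] -/
theorem typ_of_mem (D : OrbitQDatum G A) {r : V} (hr : r ∈ D.reps) : D.typ r = r := otyp_of_mem D.cover D.trans hr

/-- `typ (a • w) = typ w`. [folklore] -/
theorem typ_smul (D : OrbitQDatum G A) (a : A) (w : V) : D.typ (a • w) = D.typ w := otyp_smul D.cover D.trans a w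

/-- `sec r` stabilises a representative `r`. [folklore] -/
theorem sec_mem_stabilizer (D : OrbitQDatum G A) {r : V} (hr : r ∈ D.reps) : D.sec r ∈ MulAction.stabilizer A r := by
  rw [MulAction.mem_stabilizer_iff]
  have h := D.sec_smul r
  rwa [D.typ_of_mem hr] at h

/-! ### The zero-offset equivariant chart -/

/-- **The chart of `G`**: `φ w := ψ (sec w)` (offset zero on every representative). [folklore] -/
def chart (D : OrbitQDatum G A) (w : V) : Site 2 := D.ψ (D.sec w)

/-- `φ w = ψ (sec w)`. [folklore] -/
theorem chart_eq (D : OrbitQDatum G A) (w : V) : D.chart w = D.ψ (D.sec w) := rfl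

/-- **Equivariance**: `φ (a • w) = ψ a + φ w` (the type is `A`-invariant and `ψ` kills its stabiliser). [folklore] -/
theorem chart_smul (D : OrbitQDatum G A) (a : A) (w : V) : D.chart (a • w) = D.ψ a + D.chart w := by
  unfold chart
  have h : ((D.sec (a • w))⁻¹ * (a * D.sec w)) • D.typ w = D.typ w := by
    rw [mul_smul, mul_smul, D.sec_smul, inv_smul_eq_iff, ← D.typ_smul a w, D.sec_smul]
  have h0 := D.ψ_stab _ _ (MulAction.mem_stabilizer_iff.2 h)
  rw [D.ψ_mul, D.ψ_mul, D.ψ_inv] at h0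
  exact neg_add_eq_zero.1 h0

/-- **`φ = 0` on the representatives.** [folklore] -/
theorem chart_of_mem (D : OrbitQDatum G A) {r : V} (hr : r ∈ D.reps) : D.chart r = 0 := D.ψ_stab r _ (D.sec_mem_stabilizer hr)

/-- `φ (typ w) = 0`. [folklore] -/
theorem chart_typ (D : OrbitQDatum G A) (w : V) : D.chart (D.typ w) = 0 := D.chart_of_mem (D.typ_mem w)

/-- `φ (a • r) = ψ a` for a representative `r`. [folklore] -/
theorem chart_smul_of_mem (D : OrbitQDatum G A) (a : A) {r : V} (hr : r ∈ D.reps) : D.chart (a • r) = D.ψ a := by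
  rw [D.chart_smul, D.chart_of_mem hr, add_zero]

/-- **`φ` is `N`-Lipschitz along edges** (every edge is a translate of an edge at a representative). [folklore] -/
theorem chart_lip (D : OrbitQDatum G A) {u v : V} (huv : G.Adj u v) (i : Fin 2) : |D.chart u i - D.chart v i| ≤ D.N := by
  set b := D.sec u with hb
  have hut : b⁻¹ • u = D.typ u := by rw [inv_smul_eq_iff, D.sec_smul]
  have hadj : G.Adj (D.typ u) (b⁻¹ • v) := by
    have h := (D.act b⁻¹ u v).2 huv
    rwa [hut] at h
  have hv : b⁻¹ • v = D.sec (b⁻¹ • v) • D.typ (b⁻¹ • v) := (D.sec_smul _).symm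
  have hlip := D.lipN (D.typ u) (D.typ_mem u) (D.typ (b⁻¹ • v)) (D.typ_mem _) (D.sec (b⁻¹ • v)) (by rw [← hv]; exact hadj) i
  have hcv : D.chart v = D.ψ b + D.chart (b⁻¹ • v) := by
    conv_lhs => rw [← smul_inv_smul b v]
    rw [D.chart_smul]
  rw [hcv, Pi.add_apply, show D.chart u = D.ψ b from rfl, sub_add_cancel_left, abs_neg]
  exact hlip


/-- **Tight quasi-steps at every vertex**: a walk of length `≤ M` to a vertex with chart `φ v + N σ eᵢ` along which the chart stays within sup-distance `N` of
`φ v` (translate the representative's quasi-step by `sec v`). [folklore] -/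
theorem qstep_at (D : OrbitQDatum G A) (v : V) (i : Fin 2) (σ : ℤˣ) :
    ∃ (v' : V) (p : G.Walk v v'), p.length ≤ D.M ∧ D.chart v' = D.chart v + Pi.single i ((D.N : ℤ) * σ) ∧
      ∀ x ∈ p.support, ∀ j : Fin 2, |D.chart x j - D.chart v j| ≤ D.N := by
  obtain ⟨a, r', p, hr', hlen, hψ, htight⟩ := D.qstep (D.typ v) (D.typ_mem v) i σ
  have hstart : D.sec v • D.typ v = v := D.sec_smul v
  refine ⟨D.sec v • (a • r'), (p.map (smulIso D.act (D.sec v)).toHom).copy hstart rfl, ?_, ?_, ?_⟩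
  · rw [Walk.length_copy, Walk.length_map]; exact hlen
  · rw [D.chart_smul, D.chart_smul_of_mem _ hr', hψ]
    rfl
  · intro x hx j
    rw [Walk.support_copy] at hx
    obtain ⟨x₀, hx₀, rfl⟩ := exists_mem_support_of_map_smul D.act (D.sec v) p hx
    obtain ⟨b, r'', hr'', rfl⟩ := D.cover x₀
    have hb := htight _ hx₀ b r'' hr'' rfl j
    rw [D.chart_smul, D.chart_smul_of_mem _ hr'', Pi.add_apply]
    have e : D.chart v = D.ψ (D.sec v) := rfl
    rw [e, add_sub_cancel_left]
    exact hb

/-! ### Walks inside chart boxes -/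

/-- `u` and `v` are joined by a walk along which the chart stays in the box of radius `R` (about `0`, the common chart value of the
representatives). [folklore] -/
def InBox (D : OrbitQDatum G A) (R : ℕ) (u v : V) : Prop := ∃ w : G.Walk u v, ∀ z ∈ w.support, D.chart z ∈ box 2 R

/-- Transitivity of `InBox`. [folklore] -/
theorem inBox_trans (D : OrbitQDatum G A) {R : ℕ} {u v w : V} (h₁ : D.InBox R u v) (h₂ : D.InBox R v w) : D.InBox R u w := by
  obtain ⟨w₁, hw₁⟩ := h₁
  obtain ⟨w₂, hw₂⟩ := h₂
  refine ⟨w₁.append w₂, fun z hz => ?_⟩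
  rw [Walk.support_append, List.mem_append] at hz
  rcases hz with hz | hz
  · exact hw₁ z hz
  · exact hw₂ z (List.tail_subset _ hz)

/-- Symmetry of `InBox`. [folklore] -/
theorem inBox_symm (D : OrbitQDatum G A) {R : ℕ} {u v : V} (h : D.InBox R u v) : D.InBox R v u := by
  obtain ⟨w, hw⟩ := h
  exact ⟨w.reverse, fun z hz => hw z (by rwa [Walk.support_reverse, List.mem_reverse] at hz)⟩

/-- Monotonicity of `InBox` in the radius. [folklore] -/
theorem inBox_mono (D : OrbitQDatum G A) {R R' : ℕ} (hR : R ≤ R') {u v : V} (h : D.InBox R u v) : D.InBox R' u v := by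
  obtain ⟨w, hw⟩ := h
  exact ⟨w, fun z hz => box_mono 2 hR (hw z hz)⟩

/-- The trivial boxed walk at a representative. [folklore] -/
theorem inBox_refl_of_mem (D : OrbitQDatum G A) (R : ℕ) {r : V} (hr : r ∈ D.reps) : D.InBox R r r := by
  refine ⟨Walk.nil, fun z hz => ?_⟩
  rw [Walk.support_nil, List.mem_singleton] at hz
  subst hz
  rw [D.chart_of_mem hr]
  exact zero_mem_box 2 R

/-- The support of a translated walk is the translate of the support. [folklore] -/
theorem mem_support_map_smul (D : OrbitQDatum G A) (a : A) {u v : V} (w : G.Walk u v) {z : V}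
    (hz : z ∈ (w.map (smulIso D.act a).toHom).support) : ∃ z₀ ∈ w.support, a • z₀ = z := by
  induction w with
  | nil =>
    rw [Walk.map_nil, Walk.support_nil, List.mem_singleton] at hz
    exact ⟨_, Walk.start_mem_support _, hz.symm⟩
  | cons h w ih =>
    rw [Walk.map_cons, Walk.support_cons, List.mem_cons] at hz
    rcases hz with hz | hz
    · exact ⟨_, Walk.start_mem_support _, hz.symm⟩
    · obtain ⟨z₀, hz₀, rfl⟩ := ih hz
      exact ⟨z₀, by rw [Walk.support_cons]; exact List.mem_cons_of_mem _ hz₀, rfl⟩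

/-- **Translating a boxed walk**: by `a` with `‖ψ a‖_∞ ≤ S`, the box radius grows by `S`. [folklore] -/
theorem inBox_smul (D : OrbitQDatum G A) (a : A) {S : ℕ} (ha : ∀ i : Fin 2, |D.ψ a i| ≤ S) {R : ℕ} {u v : V} (h : D.InBox R u v) :
    D.InBox (S + R) (a • u) (a • v) := by
  obtain ⟨w, hw⟩ := h
  refine ⟨w.map (smulIso D.act a).toHom, fun z hz => ?_⟩
  obtain ⟨z₀, hz₀, rfl⟩ := D.mem_support_map_smul a w hz
  have hb := hw z₀ hz₀
  rw [mem_box] at hb ⊢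
  intro i
  rw [D.chart_smul, Pi.add_apply]
  have h1 := hb i
  have h2 := ha i
  rw [abs_le] at h2
  push_cast
  constructor <;> omega

/-- **Along a walk of length `ℓ` the chart moves by at most `N ℓ`** per coordinate. [folklore] -/
theorem chart_walk_bound (D : OrbitQDatum G A) :
    ∀ {u v : V} (w : G.Walk u v), ∀ z ∈ w.support, ∀ i : Fin 2, |D.chart z i - D.chart u i| ≤ D.N * w.length
  | _, _, Walk.nil => by
    intro z hz i
    rw [Walk.support_nil, List.mem_singleton] at hz
    subst hz
    simp
  | u, _, Walk.cons (v := u') h w => by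
    intro z hz i
    rw [Walk.support_cons, List.mem_cons] at hz
    rw [Walk.length_cons]
    rcases hz with rfl | hz
    · simp
    · have ih := chart_walk_bound D w z hz i
      have hl := D.chart_lip h i
      rw [abs_le] at ih hl ⊢
      push_cast at ih ⊢
      constructor <;> nlinarith

/-- A vertex of `B(r, n)`, `r` a representative, is joined to `r` inside the box of radius `N n`. [folklore] -/
theorem inBox_of_mem_graphBall (D : OrbitQDatum G A) {r : V} (hr : r ∈ D.reps) {v : V} {n : ℕ} (hv : v ∈ graphBall G r n) :
    D.InBox (D.N * n) r v := by
  obtain ⟨w, hw⟩ := hv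
  refine ⟨w, fun z hz => ?_⟩
  rw [mem_box]
  intro i
  have h := D.chart_walk_bound w z hz i
  rw [D.chart_of_mem hr, Pi.zero_apply, sub_zero, abs_le] at h
  have hmono : (D.N : ℤ) * w.length ≤ (D.N : ℤ) * n := by exact_mod_cast Nat.mul_le_mul_left D.N hw
  push_cast
  constructor <;> linarith [h.1, h.2]

/-- **Kernel walks**: every `k ∈ ker ψ` moves a representative `r` along a walk inside the box of radius `N m` (closure induction over the bounded kernel
generators at the base `r`; kernel translates do not move the chart). [cite: MilnorSolvableGrowth1968, Lemma 1] -/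
theorem ker_inBox (D : OrbitQDatum G A) {r : V} (hr : r ∈ D.reps) {k : A} (hk : D.ψ k = 0) : D.InBox (D.N * D.m) r (k • r) := by
  have hmem := D.ker_gen r hr k hk
  suffices H : D.ψ k = 0 ∧ D.InBox (D.N * D.m) r (k • r) from H.2
  clear hk
  induction hmem using Subgroup.closure_induction with
  | mem g hg => exact ⟨hg.1, D.inBox_of_mem_graphBall hr hg.2⟩
  | one =>
    refine ⟨D.ψ_one, ?_⟩
    rw [one_smul]
    exact D.inBox_refl_of_mem _ hr
  | mul x y _ _ hx hy =>
    obtain ⟨hx0, hbx⟩ := hx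
    obtain ⟨hy0, hby⟩ := hy
    refine ⟨by rw [D.ψ_mul, hx0, hy0, add_zero], ?_⟩
    have h2 := D.inBox_smul x (S := 0) (fun i => by rw [hx0, Pi.zero_apply, abs_zero]; rfl) hby
    rw [Nat.zero_add] at h2
    rw [mul_smul]
    exact D.inBox_trans hbx h2
  | inv x _ hx =>
    obtain ⟨hx0, hbx⟩ := hx
    have hx0' : D.ψ x⁻¹ = 0 := by rw [D.ψ_inv, hx0, neg_zero]
    refine ⟨hx0', ?_⟩
    have h2 := D.inBox_smul x⁻¹ (S := 0) (fun i => by rw [hx0', Pi.zero_apply, abs_zero]; rfl) hbx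
    rw [Nat.zero_add, inv_smul_smul] at h2
    exact D.inBox_symm h2

/-- A boxed walk of radius `R ≤ ℓ` is a walk of the cylinder of width `ℓ` at a representative. [folklore] -/
theorem reach_of_inBox (D : OrbitQDatum G A) {r : V} (hr : r ∈ D.reps) {ℓ R : ℕ} (hR : R ≤ ℓ) {u v : V} (h : D.InBox R u v)
    (hu : u ∈ {w | D.chart w - D.chart r ∈ box 2 ℓ}) (hv : v ∈ {w | D.chart w - D.chart r ∈ box 2 ℓ}) :
    (G.induce {w | D.chart w - D.chart r ∈ box 2 ℓ}).Reachable ⟨u, hu⟩ ⟨v, hv⟩ := by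
  obtain ⟨w, hw⟩ := h
  have hw' : ∀ z ∈ w.support, z ∈ {w | D.chart w - D.chart r ∈ box 2 ℓ} := fun z hz => by
    show D.chart z - D.chart r ∈ box 2 ℓ
    rw [D.chart_of_mem hr, sub_zero]
    exact box_mono 2 hR (hw z hz)
  exact ⟨w.induce _ hw'⟩


end OrbitQDatum

end AutChart

end Summit.CriticalPhenomena.PercolationContinuityZ3.Theorems.Transplant

end
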